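import Literature.Computability.Cryptography.RegevSamplerWords
import Literature.Computability.QuantumComplexity.CleanBlockInput
import HarnessLib

/-!
# Regev 2009, Lemma 3.14 in machine form: the block functions of the classical stage (parameters read off the input zone)

Topic `Computability/Cryptography` (family `pqc`), grouping namespace `Regev2009.SamplerWordFns`; sequel of
`RegevSamplerWords.lean` (the three words `wordY`/`wordS`/`wordX` of the sampler's classical stage as
typed maps of the arithmetic parameters `P = ((rows B, rows Bᵀ), (|det B|, sign det B))`, `R`, and the
register contents, with `CodeFP` facts) and `QuantumComplexity/CleanBlockInput.lean` (one machine for all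
parameters from a `CodeFP` fact on the pair code `⟨suffix parameters, data word⟩`). For UNIFORMITY the
instance parameters cannot be part of the circuit: they sit on the INPUT wires of the sampler, whose
content `u = F_q ++ ⟨⟨P_all⟩, ε⟩ ++ 0…0` (`RegevSamplerParams.lean`: `F_q` the query prefix of length
`Lq`, then the self-delimited code of the parameter record `P_all = ((P, R), S)`, then padding) every
block machine reads as the tail of its data word; only length-derived numbers (`n`, `ℓ`, widths, `Lq`)
sit in the block's constant suffix. This file turns the typed words into such block functions:

* `PAll`, `pallE`; the input zone `zoneOf Fq P pad = Fq ++ ⟨⟨P⟩, ε⟩ ++ pad` and the parsers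
  `parStr/rStr/atSgStr` (nested `fstF`/`sndF` after dropping `Lq`), with their values on a zone
  (`parStr_zone`, `rStr_zone`, `atSgStr_zone`);
* the block functions **`FY`**, **`FS`**, **`FX`** (`= f_W (code assembled from the data word)`, `f_W`
  the `FP` function of `codeFP_wordW`), their `CodeFP` facts on the pair codes (`codeFP_FY/FS/FX`) and
  their values on admissible data words (**`FY_eq`**, **`FS_eq`**, **`FX_eq`**: the typed words);
* hence the three fixed machines with power time bounds (`exists_machineY/S/X`,
  `CleanBlockInput.exists_blockMachine`).

Everything is proved; definitions have bodies; no named fact is introduced.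

## References

* O. Regev, *On lattices, learning with errors, random linear codes, and cryptography*, J. ACM 56
  (2009), art. 34; author's version arXiv:2401.03703: Lemma 3.14 (proof) [Regev2009].
* E. Bernstein, U. Vazirani, *Quantum complexity theory*, SIAM J. Comput. 26 (1997), §8 (uniform
  families: the circuit depends on the input length only) [BernsteinVazirani1997].
* S. Arora, B. Barak, *Computational Complexity: A Modern Approach*, CUP 2009, §1.3, §6.2 [AroraBarak2009].
-/

noncomputable section

namespace Literature.Computability.Cryptography

namespace Regev2009

namespace SamplerWordFns

open Literature.Algebra.EuclideanLattices Literature.Computability.Complexity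
  Literature.Computability.Complexity.CodeFP SamplerArithFP SamplerWords
  Literature.Computability.QuantumComplexity
open Literature.Computability.Complexity.Brick (fstF sndF fstF_mem_FP sndF_mem_FP fstF_boolPair sndF_boolPair)
open _root_.Computability

/-- Integer vectors: raw lists of canonical integer codes. -/
local notation "ivecE" => rawE intE

/-- Integer matrices: raw lists of rows. -/
local notation "zmatE" => rawE (rawE intE)

/-! ### The parameter record and the input zone -/

/-- **The parameter record of an instance**: the arithmetic parameters `P`, the modulus `R`, the cell
constant `S` of the Grover–Rudolph stage. [cite: Regev2009, Lemma 3.14 (proof)] -/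
abbrev PAll : Type := (Par × ℕ) × ℚ

/-- Its code. [folklore] -/
abbrev pallE : PAll → List Bool := pairE (pairE parE natE) encodeRat

/-- **The content of the input zone**: the query prefix, the self-delimited parameter code, padding. [folklore] -/
def zoneOf (Fq : List Bool) (Pa : PAll) (pad : List Bool) : List Bool := Fq ++ (boolPair (pallE Pa) [] ++ pad)

/-- A self-delimited code followed by anything has the code as its first field. [folklore] -/
theorem fstF_boolPair_nil_append (a w : List Bool) : fstF (boolPair a [] ++ w) = a := by
  rw [show boolPair a [] ++ w = boolPair a w by simp [boolPair], fstF_boolPair]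

/-- **The code of `P` read off a zone**: `fstF (fstF (fstF (drop Lq zone)))`. [folklore] -/
def parStr (Lq : ℕ) (uz : List Bool) : List Bool := fstF (fstF (fstF (uz.drop Lq)))

/-- **The code of `R` read off a zone.** [folklore] -/
def rStr (Lq : ℕ) (uz : List Bool) : List Bool := sndF (fstF (fstF (uz.drop Lq)))

/-- **The code of `(rows Bᵀ, sign det B)` read off a zone.** [folklore] -/
def atSgStr (Lq : ℕ) (uz : List Bool) : List Bool := boolPair (sndF (fstF (parStr Lq uz))) (sndF (sndF (parStr Lq uz)))

/-- The parsers on a zone. [folklore] -/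
theorem parStr_zone (Fq : List Bool) (Pa : PAll) (pad : List Bool) : parStr Fq.length (zoneOf Fq Pa pad) = parE Pa.1.1 := by
  unfold parStr zoneOf
  rw [List.drop_left, fstF_boolPair_nil_append]
  simp only [pairE_apply, fstF_boolPair]

/-- The parsers on a zone. [folklore] -/
theorem rStr_zone (Fq : List Bool) (Pa : PAll) (pad : List Bool) : rStr Fq.length (zoneOf Fq Pa pad) = natE Pa.1.2 := by
  unfold rStr zoneOf
  rw [List.drop_left, fstF_boolPair_nil_append]
  simp only [pairE_apply, fstF_boolPair, sndF_boolPair]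

/-- The parsers on a zone. [folklore] -/
theorem atSgStr_zone (Fq : List Bool) (Pa : PAll) (pad : List Bool) :
    atSgStr Fq.length (zoneOf Fq Pa pad) = pairE zmatE intE (Pa.1.1.1.2, Pa.1.1.2.2) := by
  unfold atSgStr
  rw [parStr_zone]
  simp only [pairE_apply, fstF_boolPair, sndF_boolPair]

/-- The three parsers are polynomial time (on `(1^{Lq}, zone)`). [cite: AroraBarak2009, §1.3] -/
theorem codeFP_parsers :
    CodeFP (pairE unE strE) strE (fun p => parStr p.1 p.2) ∧ CodeFP (pairE unE strE) strE (fun p => rStr p.1 p.2) ∧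
      CodeFP (pairE unE strE) strE (fun p => atSgStr p.1 p.2) := by
  have hfst : CodeFP strE strE fstF := ⟨fstF, fstF_mem_FP, fun _ => rfl⟩
  have hsnd : CodeFP strE strE sndF := ⟨sndF, sndF_mem_FP, fun _ => rfl⟩
  have hdrop : CodeFP (pairE unE strE) strE (fun p => p.2.drop p.1) := strDrop
  have h2 : CodeFP (pairE unE strE) strE (fun p => fstF (fstF (p.2.drop p.1))) := (hfst.comp (hfst.comp hdrop) :)
  have hpar : CodeFP (pairE unE strE) strE (fun p => parStr p.1 p.2) := (hfst.comp h2 :)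
  have hr : CodeFP (pairE unE strE) strE (fun p => rStr p.1 p.2) := (hsnd.comp h2 :)
  have hat : CodeFP (pairE unE strE) strE (fun p => sndF (fstF (parStr p.1 p.2))) := (hsnd.comp (hfst.comp hpar) :)
  have hsg : CodeFP (pairE unE strE) strE (fun p => sndF (sndF (parStr p.1 p.2))) := (hsnd.comp (hsnd.comp hpar) :)
  have hatsg : CodeFP (pairE unE strE) (pairE strE strE) (fun p => (sndF (fstF (parStr p.1 p.2)), sndF (sndF (parStr p.1 p.2)))) := hat.pair hsg
  exact ⟨hpar, hr, hatsg.congr fun _ => rfl⟩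

/-! ### The branch block -/

/-- The `FP` function of the typed branch word. [folklore] -/
def fY : List Bool → List Bool := codeFP_wordY.choose

/-- Suffix parameters of the branch block: `(n, (ℓ, (ℓY, Lq)))`, unary. [folklore] -/
abbrev QY : Type := ℕ × (ℕ × (ℕ × ℕ))

/-- Their code. [folklore] -/
abbrev qYE : QY → List Bool := pairE unE (pairE unE (pairE unE unE))

/-- The code data assembled from a data word `d = (point register bits) ++ (input zone)`. [folklore] -/
def HY (Q : QY) (d : List Bool) : (List Bool × (ℕ × (ℕ × ℕ))) × List Bool :=
  ((parStr Q.2.2.2 (d.drop (Q.1 * Q.2.1)), (Q.1, (Q.2.1, Q.2.2.1))), d.take (Q.1 * Q.2.1))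

/-- Its code (the branch word's input code with `P` as a raw string). [folklore] -/
abbrev cYE : (List Bool × (ℕ × (ℕ × ℕ))) × List Bool → List Bool := pairE (pairE strE (pairE unE (pairE unE unE))) strE

/-- **The branch block function.** [cite: Regev2009, Lemma 3.14 (proof)] -/
def FY (Q : QY) (d : List Bool) : List Bool := fY (cYE (HY Q d))

/-- Unary product on codes. [folklore] -/
theorem unMulNat : CodeFP (pairE unE unE) natE (fun p => p.1 * p.2) :=
  (natMul.comp ((natOfUn.comp (fst _ _)).pair (natOfUn.comp (snd _ _)))).congr fun _ => rfl

/-- **The branch block function is computed on the pair code.** [cite: AroraBarak2009, §1.3] -/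
theorem codeFP_FY : CodeFP (pairE qYE strE) strE (fun p : QY × List Bool => FY p.1 p.2) := by
  obtain ⟨hpar, -, -⟩ := codeFP_parsers
  have hn : CodeFP (pairE qYE strE) unE (fun p : QY × List Bool => p.1.1) := (fst _ _).fst'
  have hℓ : CodeFP (pairE qYE strE) unE (fun p : QY × List Bool => p.1.2.1) := (fst _ _).snd'.fst'
  have hℓY : CodeFP (pairE qYE strE) unE (fun p : QY × List Bool => p.1.2.2.1) := (fst _ _).snd'.snd'.fst'
  have hLq : CodeFP (pairE qYE strE) unE (fun p : QY × List Bool => p.1.2.2.2) := (fst _ _).snd'.snd'.snd'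
  have hd : CodeFP (pairE qYE strE) strE (fun p : QY × List Bool => p.2) := snd _ _
  have hcnt : CodeFP (pairE qYE strE) natE (fun p : QY × List Bool => p.1.1 * p.1.2.1) := (unMulNat.comp (hn.pair hℓ) :)
  have huz : CodeFP (pairE qYE strE) strE (fun p : QY × List Bool => p.2.drop (p.1.1 * p.1.2.1)) := (strDropNat.comp (hcnt.pair hd) :)
  have hxb : CodeFP (pairE qYE strE) strE (fun p : QY × List Bool => p.2.take (p.1.1 * p.1.2.1)) := (strTakeNat.comp (hcnt.pair hd) :)
  have hP : CodeFP (pairE qYE strE) strE (fun p : QY × List Bool => parStr p.1.2.2.2 (p.2.drop (p.1.1 * p.1.2.1))) := (hpar.comp (hLq.pair huz) :)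
  have hH : CodeFP (pairE qYE strE) cYE (fun p : QY × List Bool => HY p.1 p.2) :=
    ((hP.pair (hn.pair (hℓ.pair hℓY))).pair hxb).congr fun _ => rfl
  obtain ⟨fH, hfH, hHspec⟩ := hH
  exact ⟨fY ∘ fH, comp_mem_FP codeFP_wordY.choose_spec.1 hfH, fun p => by rw [Function.comp_apply, hHspec]; rfl⟩

/-- **The branch block function on an admissible data word is the branch word.** [cite: Regev2009, Lemma 3.14 (proof)] -/
theorem FY_eq (n ℓ ℓY : ℕ) (Fq : List Bool) (Pa : PAll) (pad xb : List Bool) (hxb : xb.length = n * ℓ) :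
    FY (n, (ℓ, (ℓY, Fq.length))) (xb ++ zoneOf Fq Pa pad) = wordY Pa.1.1 n ℓ ℓY xb := by
  have hH : cYE (HY (n, (ℓ, (ℓY, Fq.length))) (xb ++ zoneOf Fq Pa pad)) = pairE parYE strE ((Pa.1.1, (n, (ℓ, ℓY))), xb) := by
    unfold HY
    simp only
    rw [List.drop_left' hxb, List.take_left' hxb, parStr_zone]
    rfl
  unfold FY
  rw [hH]
  exact codeFP_wordY.choose_spec.2 ((Pa.1.1, (n, (ℓ, ℓY))), xb)

/-! ### The residue block -/

/-- The `FP` function of the typed residue word. [folklore] -/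
def fS : List Bool → List Bool := codeFP_wordS.choose

/-- Suffix parameters of the residue block: `(n, (ℓ, (ℓR, Lq)))`, unary. [folklore] -/
abbrev QS : Type := ℕ × (ℕ × (ℕ × ℕ))

/-- The code data assembled from a data word `d = (point register bits) ++ (input zone)`: `P` and `R`
as raw strings. [folklore] -/
def HS (Q : QS) (d : List Bool) : (List Bool × (List Bool × (ℕ × (ℕ × ℕ)))) × List Bool :=
  ((parStr Q.2.2.2 (d.drop (Q.1 * Q.2.1)), (rStr Q.2.2.2 (d.drop (Q.1 * Q.2.1)), (Q.1, (Q.2.1, Q.2.2.1)))), d.take (Q.1 * Q.2.1))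

/-- Its code. [folklore] -/
abbrev cSE : (List Bool × (List Bool × (ℕ × (ℕ × ℕ)))) × List Bool → List Bool :=
  pairE (pairE strE (pairE strE (pairE unE (pairE unE unE)))) strE

/-- **The residue block function.** [cite: Regev2009, Lemma 3.14 (proof)] -/
def FS (Q : QS) (d : List Bool) : List Bool := fS (cSE (HS Q d))

/-- **The residue block function is computed on the pair code.** [cite: AroraBarak2009, §1.3] -/
theorem codeFP_FS : CodeFP (pairE qYE strE) strE (fun p : QS × List Bool => FS p.1 p.2) := by
  obtain ⟨hpar, hr, -⟩ := codeFP_parsers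
  have hn : CodeFP (pairE qYE strE) unE (fun p : QS × List Bool => p.1.1) := (fst _ _).fst'
  have hℓ : CodeFP (pairE qYE strE) unE (fun p : QS × List Bool => p.1.2.1) := (fst _ _).snd'.fst'
  have hℓR : CodeFP (pairE qYE strE) unE (fun p : QS × List Bool => p.1.2.2.1) := (fst _ _).snd'.snd'.fst'
  have hLq : CodeFP (pairE qYE strE) unE (fun p : QS × List Bool => p.1.2.2.2) := (fst _ _).snd'.snd'.snd'
  have hd : CodeFP (pairE qYE strE) strE (fun p : QS × List Bool => p.2) := snd _ _
  have hcnt : CodeFP (pairE qYE strE) natE (fun p : QS × List Bool => p.1.1 * p.1.2.1) := (unMulNat.comp (hn.pair hℓ) :)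
  have huz : CodeFP (pairE qYE strE) strE (fun p : QS × List Bool => p.2.drop (p.1.1 * p.1.2.1)) := (strDropNat.comp (hcnt.pair hd) :)
  have hxb : CodeFP (pairE qYE strE) strE (fun p : QS × List Bool => p.2.take (p.1.1 * p.1.2.1)) := (strTakeNat.comp (hcnt.pair hd) :)
  have hP : CodeFP (pairE qYE strE) strE (fun p : QS × List Bool => parStr p.1.2.2.2 (p.2.drop (p.1.1 * p.1.2.1))) := (hpar.comp (hLq.pair huz) :)
  have hR : CodeFP (pairE qYE strE) strE (fun p : QS × List Bool => rStr p.1.2.2.2 (p.2.drop (p.1.1 * p.1.2.1))) := (hr.comp (hLq.pair huz) :)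
  have hH : CodeFP (pairE qYE strE) cSE (fun p : QS × List Bool => HS p.1 p.2) :=
    ((hP.pair (hR.pair (hn.pair (hℓ.pair hℓR)))).pair hxb).congr fun _ => rfl
  obtain ⟨fH, hfH, hHspec⟩ := hH
  exact ⟨fS ∘ fH, comp_mem_FP codeFP_wordS.choose_spec.1 hfH, fun p => by rw [Function.comp_apply, hHspec]; rfl⟩

/-- **The residue block function on an admissible data word is the residue word.** [cite: Regev2009, Lemma 3.14 (proof)] -/
theorem FS_eq (n ℓ ℓR : ℕ) (Fq : List Bool) (Pa : PAll) (pad xb : List Bool) (hxb : xb.length = n * ℓ) :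
    FS (n, (ℓ, (ℓR, Fq.length))) (xb ++ zoneOf Fq Pa pad) = wordS Pa.1.1 Pa.1.2 n ℓ ℓR xb := by
  have hH : cSE (HS (n, (ℓ, (ℓR, Fq.length))) (xb ++ zoneOf Fq Pa pad)) = pairE parSE strE ((Pa.1.1, (Pa.1.2, (n, (ℓ, ℓR)))), xb) := by
    unfold HS
    simp only
    rw [List.drop_left' hxb, List.take_left' hxb, parStr_zone, rStr_zone]
    rfl
  unfold FS
  rw [hH]
  exact codeFP_wordS.choose_spec.2 ((Pa.1.1, (Pa.1.2, (n, (ℓ, ℓR)))), xb)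

/-! ### The erasing block -/

/-- The `FP` function of the typed erasing word. [folklore] -/
def fX : List Bool → List Bool := codeFP_wordX.choose

/-- Suffix parameters of the erasing block: `(n, (ℓ, (ℓY, (ℓR, (bc, Lq)))))`, unary. [folklore] -/
abbrev QX : Type := ℕ × (ℕ × (ℕ × (ℕ × (ℕ × ℕ))))

/-- Their code. [folklore] -/
abbrev qXE : QX → List Bool := pairE unE (pairE unE (pairE unE (pairE unE (pairE unE unE))))

/-- The length of the register part of the erasing block's data word: `n·ℓY + n·ℓR + n·bc`. [folklore] -/
def regLen (Q : QX) : ℕ := Q.1 * Q.2.2.1 + Q.1 * Q.2.2.2.1 + Q.1 * Q.2.2.2.2.1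

/-- The code data assembled from a data word `d = (branch bits ++ residue bits ++ answer bits) ++ (input zone)`. [folklore] -/
def HX (Q : QX) (d : List Bool) : (List Bool × (List Bool × (ℕ × (ℕ × (ℕ × (ℕ × ℕ)))))) × List Bool :=
  ((atSgStr Q.2.2.2.2.2 (d.drop (regLen Q)), (rStr Q.2.2.2.2.2 (d.drop (regLen Q)), (Q.1, (Q.2.1, (Q.2.2.1, (Q.2.2.2.1, Q.2.2.2.2.1)))))),
    d.take (regLen Q))

/-- Its code. [folklore] -/
abbrev cXE : (List Bool × (List Bool × (ℕ × (ℕ × (ℕ × (ℕ × ℕ)))))) × List Bool → List Bool :=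
  pairE (pairE strE (pairE strE (pairE unE (pairE unE (pairE unE (pairE unE unE)))))) strE

/-- **The erasing block function.** [cite: Regev2009, Lemma 3.14 (proof: "recover x … uncompute the first register")] -/
def FX (Q : QX) (d : List Bool) : List Bool := fX (cXE (HX Q d))

/-- **The erasing block function is computed on the pair code.** [cite: AroraBarak2009, §1.3] -/
theorem codeFP_FX : CodeFP (pairE qXE strE) strE (fun p : QX × List Bool => FX p.1 p.2) := by
  obtain ⟨-, hr, hat⟩ := codeFP_parsers
  have hn : CodeFP (pairE qXE strE) unE (fun p : QX × List Bool => p.1.1) := (fst _ _).fst'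
  have hℓ : CodeFP (pairE qXE strE) unE (fun p : QX × List Bool => p.1.2.1) := (fst _ _).snd'.fst'
  have hℓY : CodeFP (pairE qXE strE) unE (fun p : QX × List Bool => p.1.2.2.1) := (fst _ _).snd'.snd'.fst'
  have hℓR : CodeFP (pairE qXE strE) unE (fun p : QX × List Bool => p.1.2.2.2.1) := (fst _ _).snd'.snd'.snd'.fst'
  have hbc : CodeFP (pairE qXE strE) unE (fun p : QX × List Bool => p.1.2.2.2.2.1) := (fst _ _).snd'.snd'.snd'.snd'.fst'
  have hLq : CodeFP (pairE qXE strE) unE (fun p : QX × List Bool => p.1.2.2.2.2.2) := (fst _ _).snd'.snd'.snd'.snd'.snd'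
  have hd : CodeFP (pairE qXE strE) strE (fun p : QX × List Bool => p.2) := snd _ _
  have hcnt : CodeFP (pairE qXE strE) natE (fun p : QX × List Bool => regLen p.1) :=
    (natAdd.comp ((natAdd.comp ((unMulNat.comp (hn.pair hℓY)).pair (unMulNat.comp (hn.pair hℓR)))).pair (unMulNat.comp (hn.pair hbc)))).congr
      fun _ => rfl
  have huz : CodeFP (pairE qXE strE) strE (fun p : QX × List Bool => p.2.drop (regLen p.1)) := (strDropNat.comp (hcnt.pair hd) :)
  have hw : CodeFP (pairE qXE strE) strE (fun p : QX × List Bool => p.2.take (regLen p.1)) := (strTakeNat.comp (hcnt.pair hd) :)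
  have hA : CodeFP (pairE qXE strE) strE (fun p : QX × List Bool => atSgStr p.1.2.2.2.2.2 (p.2.drop (regLen p.1))) := (hat.comp (hLq.pair huz) :)
  have hR : CodeFP (pairE qXE strE) strE (fun p : QX × List Bool => rStr p.1.2.2.2.2.2 (p.2.drop (regLen p.1))) := (hr.comp (hLq.pair huz) :)
  have hH : CodeFP (pairE qXE strE) cXE (fun p : QX × List Bool => HX p.1 p.2) :=
    ((hA.pair (hR.pair (hn.pair (hℓ.pair (hℓY.pair (hℓR.pair hbc)))))).pair hw).congr fun _ => rfl
  obtain ⟨fH, hfH, hHspec⟩ := hH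
  exact ⟨fX ∘ fH, comp_mem_FP codeFP_wordX.choose_spec.1 hfH, fun p => by rw [Function.comp_apply, hHspec]; rfl⟩

/-- **The erasing block function on an admissible data word is the erasing word.** [cite: Regev2009, Lemma 3.14 (proof)] -/
theorem FX_eq (n ℓ ℓY ℓR bc : ℕ) (Fq : List Bool) (Pa : PAll) (pad w : List Bool) (hw : w.length = n * ℓY + n * ℓR + n * bc) :
    FX (n, (ℓ, (ℓY, (ℓR, (bc, Fq.length))))) (w ++ zoneOf Fq Pa pad) = wordX Pa.1.1.1.2 Pa.1.1.2.2 Pa.1.2 n ℓ ℓY ℓR bc w := by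
  have hreg : regLen (n, (ℓ, (ℓY, (ℓR, (bc, Fq.length))))) = w.length := by rw [hw]; rfl
  have hH : cXE (HX (n, (ℓ, (ℓY, (ℓR, (bc, Fq.length))))) (w ++ zoneOf Fq Pa pad)) =
      pairE parXE strE (((Pa.1.1.1.2, Pa.1.1.2.2), (Pa.1.2, (n, (ℓ, (ℓY, (ℓR, bc)))))), w) := by
    unfold HX
    rw [hreg, List.drop_left, List.take_left, atSgStr_zone, rStr_zone]
    rfl
  unfold FX
  rw [hH]
  exact codeFP_wordX.choose_spec.2 (((Pa.1.1.1.2, Pa.1.1.2.2), (Pa.1.2, (n, (ℓ, (ℓY, (ℓR, bc)))))), w)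

/-! ### The machines -/

/-- **The branch machine** (fixed, power time bound, all parameters). [cite: AroraBarak2009, §1.3] -/
theorem exists_machineY : ∃ (e : ℕ) (M : Turing.TM2ComputableAux Bool Bool), ∀ (Q : QY) (d : List Bool),
    M.OutputsWithin (d ++ CleanBlockInput.suffix (qYE Q) d.length) (FY Q d) (RevSim.Tn e (d ++ CleanBlockInput.suffix (qYE Q) d.length).length) :=
  CleanBlockInput.exists_blockMachine codeFP_FY

/-- **The residue machine.** [cite: AroraBarak2009, §1.3] -/
theorem exists_machineS : ∃ (e : ℕ) (M : Turing.TM2ComputableAux Bool Bool), ∀ (Q : QS) (d : List Bool),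
    M.OutputsWithin (d ++ CleanBlockInput.suffix (qYE Q) d.length) (FS Q d) (RevSim.Tn e (d ++ CleanBlockInput.suffix (qYE Q) d.length).length) :=
  CleanBlockInput.exists_blockMachine codeFP_FS

/-- **The erasing machine.** [cite: AroraBarak2009, §1.3] -/
theorem exists_machineX : ∃ (e : ℕ) (M : Turing.TM2ComputableAux Bool Bool), ∀ (Q : QX) (d : List Bool),
    M.OutputsWithin (d ++ CleanBlockInput.suffix (qXE Q) d.length) (FX Q d) (RevSim.Tn e (d ++ CleanBlockInput.suffix (qXE Q) d.length).length) :=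
  CleanBlockInput.exists_blockMachine codeFP_FX

end SamplerWordFns

end Regev2009

end Literature.Computability.Cryptography

end
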